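import Mathlib
import Summits.AnomalousDissipation.AnomalousDissipation.Theorems.SoloBlindResolventTaylor

/-!
# SoloBlind — Neumann series under a POWER-norm condition (kernel K-R14: the γ-cell at a point)

ENGINE L must certify the LEMMA-P chains over a cell in `γ = g⁴`.  At a sheared point the folded chain matrix is
`T(γ) = T(γ₀) + F(δγ)` with `F` a (diagonal + rank-one) matrix polynomial in `δγ`, and the perturbation is only
RELATIVELY bounded: `‖T(γ₀)⁻¹ F‖` may exceed `1` while a power `‖(T(γ₀)⁻¹F)^p‖^{1/p}` is `≈ |δγ|/γ₀ < 1`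
(prototype j346285: spectral radius of `γ S D` equals `1.00` at every test point).  This file gives the Neumann
calculus under the hypothesis `‖s^p‖ < 1` for some `p ≥ 1` (instead of `‖s‖ < 1`), in a complete normed ring with
`‖1‖ = 1`:

* `isUnit_oneSub_of_pow` — `1 - s` is a unit;  `inverse_oneSub_eq` — `(1-s)⁻¹ = (∑_{k<p} s^k)(1 - s^p)⁻¹`;
* `geom_sum_block` — `∑_{n<pm} s^n = (∑_{k<p} s^k) ∑_{j<m} (s^p)^j`;
* `inverse_oneSub_sub_geom_le` — BLOCK REMAINDER `‖(1-s)⁻¹ - ∑_{n<pm} s^n‖ ≤ ‖∑_{k<p} s^k‖ · ‖s^p‖^m / (1 - ‖s^p‖)`;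
* `isUnit_add_of_pow`, `inverse_add_eq`, `inverse_add_sub_geom_le` — the perturbed-unit form `u + f = u (1 - s)`,
  `s = -u⁻¹ f`, `(u+f)⁻¹ = (1-s)⁻¹ u⁻¹` and its remainder.

The engine evaluates the coefficients `(u⁻¹F)ⁿu⁻¹` exactly at the point (ball matrices, cancellations kept) and bounds
`‖s^p‖` over the cell by coefficient norms; this replaces Taylor models of degree 32 in `g` (PLAN §126, remedy R14).
-/

namespace Summit.AnomalousDissipation.SoloBlind.PowerNeumann

open Finset
open Summit.AnomalousDissipation.AnomalousDissipation.Theorems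
open Summit.AnomalousDissipation.AnomalousDissipation.Theorems.ResolventTaylor

variable {A : Type*} [NormedRing A] [NormOneClass A] [CompleteSpace A]

omit [NormOneClass A] [CompleteSpace A] in
/-- Block decomposition of a geometric sum: `∑_{n < p m} s^n = (∑_{k<p} s^k) · ∑_{j<m} (s^p)^j`. -/
theorem geom_sum_block (s : A) (p m : ℕ) :
    ∑ n ∈ range (p * m), s ^ n = (∑ k ∈ range p, s ^ k) * ∑ j ∈ range m, (s ^ p) ^ j := by
  induction m with
  | zero => simp
  | succ m ih =>
    rw [Finset.sum_range_succ, mul_add_one, mul_add, ← ih,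
      ← Finset.sum_range_add_sum_Ico _ (Nat.le_add_right (p * m) p),
      Finset.sum_Ico_eq_sum_range, Nat.add_sub_cancel_left, Finset.sum_mul]
    congr 1
    refine Finset.sum_congr rfl fun k _ => ?_
    rw [← pow_mul, ← pow_add, add_comm]

omit [NormOneClass A] in
/-- **Power Neumann criterion**: if `‖s^p‖ < 1` for some `p ≥ 1` then `1 - s` is a unit. -/
theorem isUnit_oneSub_of_pow {s : A} {p : ℕ} (hp : 0 < p) (h : ‖s ^ p‖ < 1) : IsUnit (1 - s) := by
  have _ := hp
  have hw : IsUnit (1 - s ^ p) := ⟨Units.oneSub (s ^ p) h, rfl⟩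
  have h1 : (∑ k ∈ range p, s ^ k) * (1 - s) = 1 - s ^ p := geom_sum_mul_neg s p
  have h2 : (1 - s) * ∑ k ∈ range p, s ^ k = 1 - s ^ p := mul_neg_geom_sum s p
  have hc : Commute (1 - s) (∑ k ∈ range p, s ^ k) := by
    show (1 - s) * _ = _ * (1 - s)
    rw [h2, h1]
  rw [← h2] at hw
  exact (hc.isUnit_mul_iff.mp hw).1

omit [NormOneClass A] in
/-- The inverse in closed form: `(1-s)⁻¹ = (∑_{k<p} s^k) · (1 - s^p)⁻¹`. -/
theorem inverse_oneSub_eq {s : A} {p : ℕ} (hp : 0 < p) (h : ‖s ^ p‖ < 1) :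
    Ring.inverse (1 - s) = (∑ k ∈ range p, s ^ k) * (↑(Units.oneSub (s ^ p) h)⁻¹ : A) := by
  obtain ⟨u, hu⟩ := isUnit_oneSub_of_pow hp h
  rw [← hu, Ring.inverse_unit]
  apply Units.inv_eq_of_mul_eq_one_right
  rw [hu, ← mul_assoc, mul_neg_geom_sum]
  show (↑(Units.oneSub (s ^ p) h) : A) * _ = 1
  exact Units.mul_inv _

/-- **Block remainder** (closed form): `‖(1-s)⁻¹ - (∑_{k<p} s^k) ∑_{j<m} (s^p)^j‖ ≤ ‖∑_{k<p} s^k‖ · ‖s^p‖^m/(1-‖s^p‖)`. -/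
theorem inverse_oneSub_sub_block_le {s : A} {p : ℕ} (hp : 0 < p) (h : ‖s ^ p‖ < 1) (m : ℕ) :
    ‖Ring.inverse (1 - s) - (∑ k ∈ range p, s ^ k) * ∑ j ∈ range m, (s ^ p) ^ j‖
      ≤ ‖∑ k ∈ range p, s ^ k‖ * (‖s ^ p‖ ^ m / (1 - ‖s ^ p‖)) := by
  rw [inverse_oneSub_eq hp h, ← mul_sub]
  exact (norm_mul_le _ _).trans
    (mul_le_mul_of_nonneg_left (norm_oneSub_inv_sub_geom_sum_le h m) (norm_nonneg _))

/-- **Block remainder** for the plain partial sums: `‖(1-s)⁻¹ - ∑_{n<pm} s^n‖ ≤ ‖∑_{k<p} s^k‖ · ‖s^p‖^m/(1-‖s^p‖)`. -/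
theorem inverse_oneSub_sub_geom_le {s : A} {p : ℕ} (hp : 0 < p) (h : ‖s ^ p‖ < 1) (m : ℕ) :
    ‖Ring.inverse (1 - s) - ∑ n ∈ range (p * m), s ^ n‖
      ≤ ‖∑ k ∈ range p, s ^ k‖ * (‖s ^ p‖ ^ m / (1 - ‖s ^ p‖)) := by
  rw [geom_sum_block]; exact inverse_oneSub_sub_block_le hp h m

/-! ### Perturbed-unit form `u + f = u (1 - s)`, `s = -u⁻¹ f` -/

omit [NormOneClass A] [CompleteSpace A] in
/-- The factorisation `u + f = u · (1 - s)` with `s = -(u⁻¹ f)`. -/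
theorem add_eq_mul_oneSub (u : Aˣ) (f : A) : (↑u + f : A) = ↑u * (1 - -(↑u⁻¹ * f)) := by
  rw [sub_neg_eq_add, mul_add, mul_one, ← mul_assoc, Units.mul_inv, one_mul]

omit [NormOneClass A] in
/-- `u + f` is a unit as soon as `‖(-(u⁻¹ f))^p‖ < 1` for some `p ≥ 1`. -/
theorem isUnit_add_of_pow (u : Aˣ) (f : A) {p : ℕ} (hp : 0 < p) (h : ‖(-(↑u⁻¹ * f)) ^ p‖ < 1) :
    IsUnit (↑u + f : A) := by
  rw [add_eq_mul_oneSub]; exact (Units.isUnit u).mul (isUnit_oneSub_of_pow hp h)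

omit [NormOneClass A] in
/-- The perturbed inverse: `(u+f)⁻¹ = (1-s)⁻¹ u⁻¹`. -/
theorem inverse_add_eq (u : Aˣ) (f : A) {p : ℕ} (hp : 0 < p) (h : ‖(-(↑u⁻¹ * f)) ^ p‖ < 1) :
    Ring.inverse (↑u + f : A) = Ring.inverse (1 - -(↑u⁻¹ * f)) * ↑u⁻¹ := by
  obtain ⟨v, hv⟩ := isUnit_oneSub_of_pow hp h
  have e : (↑u + f : A) = ↑(u * v) := by rw [Units.val_mul, hv, ← add_eq_mul_oneSub]
  rw [e, Ring.inverse_unit, ← hv, Ring.inverse_unit, mul_inv_rev, Units.val_mul]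

/-- **Remainder for the perturbed inverse**: with `s = -(u⁻¹f)`,
`‖(u+f)⁻¹ - (∑_{n<pm} s^n) u⁻¹‖ ≤ ‖∑_{k<p} s^k‖ · ‖s^p‖^m/(1-‖s^p‖) · ‖u⁻¹‖`. -/
theorem inverse_add_sub_geom_le (u : Aˣ) (f : A) {p : ℕ} (hp : 0 < p) (h : ‖(-(↑u⁻¹ * f)) ^ p‖ < 1) (m : ℕ) :
    ‖Ring.inverse (↑u + f : A) - (∑ n ∈ range (p * m), (-(↑u⁻¹ * f)) ^ n) * ↑u⁻¹‖
      ≤ ‖∑ k ∈ range p, (-(↑u⁻¹ * f)) ^ k‖ *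
          (‖(-(↑u⁻¹ * f)) ^ p‖ ^ m / (1 - ‖(-(↑u⁻¹ * f)) ^ p‖)) * ‖(↑u⁻¹ : A)‖ := by
  rw [inverse_add_eq u f hp h, ← sub_mul]
  exact (norm_mul_le _ _).trans
    (mul_le_mul_of_nonneg_right (inverse_oneSub_sub_geom_le hp h m) (norm_nonneg _))

end Summit.AnomalousDissipation.SoloBlind.PowerNeumann
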